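import Literature.MathematicalPhysics.QuantumFieldTheory.BalabanImbrieJaffe1984to88.BIJ88Decay241RegularTorusCwtUniform
import Literature.MathematicalPhysics.QuantumFieldTheory.BalabanImbrieJaffe1984to88.BIJ88Decay241SmallPlaquetteTorus
import Literature.MathematicalPhysics.QuantumFieldTheory.BalabanImbrieJaffe1984to88.BIJ88BgInvariance416Torus

/-!
# `BalabanImbrieJaffe1984to88.BIJ88Decay241RegularTorusCwtOrbit` — T. Bałaban, J. Imbrie, A. Jaffe, *Effective action and cluster properties
of the abelian Higgs model*, Commun. Math. Phys. **114** (1988) 257–315 [BalabanImbrieJaffe1988], §2 (2.38)–(2.41) p. 264 [PDF 8] and (4.9)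
p. 275 [PDF 19]: **(2.38), (2.40)/(4.9)_{j≥1} AND (2.41) ON THE WHOLE GAUGE ORBIT `u = (e^{ieεA})^h` OF A (2.23)-REGULAR BACKGROUND, `Ω = T_η`,
FOR THE PRINTED (2.27)/(2.29) TORUS DATA WITH BIG-BLOCK CUBES, CONSTANTS CHOSEN BEFORE THE INSTANCE — AND THE AVERAGED-FIELD SMALLNESS
DISCHARGED BY ONE SUP-NORM THRESHOLD ON `A`.**  [I] = [BalabanImbrieJaffe1985] p. 326: *«In order to remain within the framework of this
reference, we remark that by change of gauge u_k can be transformed in a local region Λ into a configuration of the form exp[ie_kηA], where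
A is smooth and small»* — the members of gen 21 (`BIJ88Decay241RegularTorusCwt`, `…Uniform`) are stated AT the representative `e^{ieεA}`;
this file carries them to every gauge transform `(e^{ieεA})^h` (hypotheses on the representative `A`, conclusions at `u^h`), and replaces
the displayed averaged-field smallness `(T₁, δ′)` of `u_k` by the single condition `L^kε|e|·‖A‖_∞ ≤ 1/(4d′L)` (*«A is … small»*).

statement-level skeleton of published theorems with citation tags; proofs where landed; nothing here is a claim about the Yang–Mills mass gap

PDF held: `paper:balaban1988-cmp114-bij-abelian-higgs-effective-action` (journal page = PDF page + 256; p. 264 = PDF 8, p. 275 = PDF 19, p. 277 =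
PDF 21), pp. 263–264 and 275–277 re-read this session (`lit read … --pages 6-9`, `18-21`); `paper:balaban1985-cmp97-bij-higgs-minimizers`
(p. 326 = PDF 28, quoted from gen 21's header).

CITATION HEADER (lean-in-tree rule).  lit-balaban cell (HOME `run/shared/lean/pub/lit-balaban/`), Phase 2, proof seat **p31 gen 22** (unit
`lit-balaban-p31`, literature-prover-lit-balaban-p31-g22-0), free-target protocol G.5-34(d), TAKING line HOME/STATUS.md 2026-08-23T05:37:11Z
(own lineage; stem check `…CwtOrbit…` = ∅; notices to r18 / p34 / r15).  Rows of `HOME/lit-balaban-r18/ROWS-C2.md` served (LOCATED MEMBERS,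
cells only; heads unchanged; owner r18): **C2.Eq2.38**, **C2.Eq2.40**, **C2.Eq2.41** (+ the (4.9)_{j≥1} token of C3) «gauge orbit of a
(2.23)-regular background; sup-norm threshold form»; **C1.Eq7.3.1-7.3.2** token (owner r15): the (7.3.2)-shape for `Δ_k(T_η,u^h)`.  USED BY
NAME, nothing restated: gen 21's `BIJ88Decay241RegularTorusCwt.ineq238_regular_torus_cwt` / §7 sup-bound lemmas,
`BIJ88Decay241RegularTorusCwtUniform.Z49_regular_torus_cwt_uniform` / `decay241_regular_torus_cwt_uniform`,
`BIJ88Decay241SmallPlaquetteTorus.ineq238_torus_smallPlaquette` / `Z49_torus_smallPlaquette` / `op240_deltaLocT_gaugeAct`, gen 19's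
`BIJ88Decay241SmallFieldTorus.op240_deltaRegion_gaugeAct`, gen 15's `BIJ88DeltaLoc234Torus.form_deltaLocT_gaugeAct` / `mulOpK`, r01/p11's
`lineIter_gaugeAct` / `toC_gaugeAct`, p34's `BIJ88BgInvariance416Torus` §5 kernels `realify_conjTranspose` / `realify_orthogonal_of_unitary` /
`Z49_conj_orthogonal` / `compress_diagonal_sandwich` / `conjTranspose_mul_diagonal_toC` (p34's `Z49_prec49_gaugeAct` is the (4.16) IDENTITY
`Z(u_k^h) = Z(u_k)` for the precision built on the corner-convention `barUc`; here the currency is gen 19–21's `lineIter`, and what is transferred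
along the orbit is the POSITIVITY triple of (2.40)/(4.9) and the bounds (2.38)/(2.41)), p03/r18's `BIJ88Normalization46.Z49_eq` / `Z49_pos`.

## The print (verbatim, p. 264 [PDF 8])

*"Finally, in view of (2.35), the lower bound (I.7.3.2) applies to Δ_{k,loc}(u) as well. Let φ be supported in a region having an r(e_k)
neighborhood where u is smooth. Then ⟨φ, Δ_{k,loc}(u)φ⟩ ≧ c₁Σ_b|u(b)φ(b₊) − φ(b₋)|² − ce_k²p(e_k)²Σ_x|φ(x)|². (2.38) Finally, we need to
construct a localized version of C^{(k)}_Λ(Ω,u) = [(Δ_k(Ω,u) + aL^{−2}Q(u_k)^*Q(u_k))|_Λ]^{−1}, (2.39) … We define C^{(k)}_Λ(u) = [(Δ_{k,loc}(u)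
+ aL^{−2}Q(u_k)^*Q(u_k))|_Λ]^{−1}. (2.40) This is of course a nonlocal operator, but by (2.38), C^{(k)}_Λ(u)^{−1} is bounded below and a random walk
expansion as in [6] can be used to prove that |C^{(k)}_Λ(u; x₁, x₂)| ≦ ce^{−c|x₁−x₂|}. (2.41)"*; p. 275 (4.9) the Gaussian normalization
`Z^{(j)}_{Λ₁₀}(u_k) = ∫𝒟φ_{Λ₁₀} exp(−½⟨Λ₁₀φ, (Δ^{L^jη}_{j,loc}(u_k) + aL^{−2}P(u_k))Λ₁₀φ⟩ − E^{(j)}_{k,s}|Λ₁₀|)`; p. 277: *"and the normalization factors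
Z^{(j)}_{Λ^{(j)}_{10}}(u_k). However, all expressions possess this invariance"* (under the background gauge transformations (4.16)).

## What is proved (0 `sorry`; theorems only — no definition, no `Prop`-valued fact)

* §0 kernels: `plaqC_gaugeAct` (the oriented plaquette variables are gauge invariant), `norm_covDiff_gaugeAct` (the covariant difference
  `u(b)φ(b₊) − φ(b₋)` keeps its modulus under `(u, φ) ↦ (u^g, gφ)`), `posDef_conj_orthogonal`, `posDef_realify_compress_unitConj` /
  `Z49_realify_compress_unitConj` (a unitary diagonal conjugation of the complex precision is an orthogonal congruence of the realified
  compressed precision: positive definiteness and `Z49` are preserved), `z49Triple_of_posDef`, `smallness_of_sup` (arithmetic).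
* §1 **(2.38) on the orbit**: `ineq238_torus_smallPlaquette_gaugeAct` (torus form `Δ_k(T_η,u^h)`, every `φ`) and
  **`ineq238_regular_torus_cwt_gaugeAct`** — gen 21's (2.38) for `Δ_{k,loc}` with the printed data, AT `u = (e^{ieεA})^h`, EVERY `h : T_ε → U(1)`,
  every `φ` supported in the deep `Λ` (the rotated field `ψ = M^{(k)ᴴ}_hφ` has the same covariant differences and the same form).
* §2 **(2.40)/(4.9)_{j≥1} on the orbit**: `Z49_deltaLocT_lineIter_gaugeAct` (the (4.16) identity `Z^{(k)}_Λ((u^h)_k) = Z^{(k)}_Λ(u_k)` in the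
  `lineIter` currency, every `u`, `h`), `Z49_torus_smallPlaquette_gaugeAct` (torus form) and **`Z49_regular_torus_cwt_uniform_gaugeAct`** —
  `realify((Δ_{k,loc}(u^h) + (A/a_k)κ̂P((u^h)_k))|_Λ)` positive definite, `Z^{(k)}_Λ` in closed form and `> 0`, constants `e₁ θ₀ ρ₀` before the
  instance, hypotheses on the representative.
* §3 **(2.41) on the orbit, constants before the instance**: **`decay241_regular_torus_cwt_uniform_gaugeAct`**.
* §4 **the sup-norm threshold**: `smallness454_of_sup` (the `σ = ½` smallness of `(e^{ieεA})_k` from the threshold), **`Z49_regular_torus_cwt_uniform_of_sup`**,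
  **`decay241_regular_torus_cwt_uniform_of_sup`** and their orbit forms `…_gaugeAct_of_sup` — the averaged-field smallness
  `‖u_k(b) − 1‖ ≤ T₁`, `‖u_k(Γ_{yx}) − 1‖ ≤ δ′`, `2(L−1)L·d′·T₁² + 2δ′² ≤ ½` of the `σ = ½` members DISCHARGED by `L^kε|e|·A_∞ ≤ 1/(4d′L)` for any
  sup bound `|A(b)| ≤ A_∞` (gen 21 §7: `T₁ = L^kε|e|A_∞`, `δ′ = d′(L−1)T₁`).

HONEST SCOPE / DIVERGENCE.  (i) Pure transport of gen 21's located members along the gauge orbit and an arithmetic discharge; no new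
analytic input.  The orbit of the regular representatives does NOT exhaust the small-plaquette fields on a torus (holonomies along
non-contractible loops are gauge invariant) — the general small-`u` members of (2.38)/(2.40)/(2.41) for `Δ_{k,loc}` still wait for the
non-flat (H1.12) input (p30 g27 (β′) in flight) and are NOT claimed here; for the torus form `Δ_k(T_η,u)` they are gen 21's
`BIJ88Decay241SmallPlaquetteTorus`.  (ii) Constants: as gen 21's `…Uniform` (`e₁, θ₀, ρ₀, δ₁, c₂` from `(d, L, a, e, c, β, κ̂, M_max, s)`,
existential through r01's `c₀(s)`); the threshold `1/(4d′L)` is one admissible choice (`2(L−1)L·d′·T₁² + 2(d′(L−1)T₁)² ≤ 4(d′LT₁)² ≤ ¼`).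
(iii) Scope as gen 21: `Ω = T_η`, big-block hulls, value members, `σ = ½`, `1 ≤ k ≤ K`, `k + 1 ≤ m + K`, fine level `0`.  Imports: gen 21's
`…Uniform` and `…SmallPlaquetteTorus`, p34's `BIJ88BgInvariance416Torus` (Literature + Mathlib only).  Unit `lit-balaban-p31`
(literature-prover-lit-balaban-p31-g22-0), 2026-08-23.  NOT summit progress.
-/

open scoped BigOperators Matrix ComplexConjugate
open Finset Matrix

namespace Literature.MathematicalPhysics.QuantumFieldTheory.BalabanImbrieJaffe1984to88.BIJ88Decay241RegularTorusCwtOrbit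

open Literature.MathematicalPhysics.QuantumFieldTheory.Balaban1983to89
open BIJ88Sect3Statements (U1 toC norm_toC)
open BIJ85BlockAveragesTorus BIJ85BlockAveragesTorusK
open BIJ88DeltaLoc234Torus (deltaLocT deltaRegion mulOpK mulOpK_mulVec form_deltaLocT_gaugeAct)
open BIJ88NeumannPropagatorFlatDecayCube (cubeT boxCoord)
open BIJ88Cutoffs21 (cutoff)
open BIJ88LocWeights227Torus (lamFam labels)
open BIJ85CovariantHiggsDictionary (expGauge)
open BIJ88Close231RegularTorusCwt (cubeFamB rowMargin)
open BIJ88Eq240FlatTorus (realify compress op240 c240)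
open BIJ88Normalization46 (Z49 Z49_eq Z49_pos)
open BIJ88Decay241FlatTorus (realify_mul)
open BIJ88BgInvariance416Torus (realify_conjTranspose realify_orthogonal_of_unitary Z49_conj_orthogonal compress_diagonal_sandwich
  conjTranspose_mul_diagonal_toC)
open BIJ88NeumannPropagator227Torus (toC_mul_conj)
open BIJ85AbelianStokes (plaqC)
open GaugeField (gaugeAct)
open BIJ88Decay241RegularTorusCwt (ineq238_regular_torus_cwt isBlockUnion_cubeFamB norm_toC_lineIter_expGauge_sub_one_le
  norm_holCK_one_sub_one_le)
open BIJ88Decay241RegularTorusCwtUniform (decay241_regular_torus_cwt_uniform Z49_regular_torus_cwt_uniform)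
open BIJ88Decay241SmallPlaquetteTorus (ineq238_torus_smallPlaquette Z49_torus_smallPlaquette op240_deltaLocT_gaugeAct)
open BIJ88Decay241SmallFieldTorus (op240_deltaRegion_gaugeAct)
open BIJ88NeumannNoZeroModesTorus (IsBlockUnion)
open B4Sect5Proof (latticeConst)

noncomputable section

variable {P : Params}

/-! ## §0 Kernels: gauge invariance of plaquettes and covariant differences; unitary conjugation as an orthogonal congruence -/

section Kernels

/-- kernel: the translations of the torus commute. [folklore] -/
private theorem shift_shift_comm {j : ℕ} (x : Balaban1983to89.Site P j) (μ ν : Fin P.d) : (x.shift μ).shift ν = (x.shift ν).shift μ := by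
  funext κ
  unfold Balaban1983to89.Site.shift
  by_cases h1 : κ = ν
  · subst h1
    by_cases h2 : κ = μ
    · subst h2; rfl
    · simp [Function.update_self, Function.update_of_ne h2]
  · by_cases h2 : κ = μ
    · subst h2
      simp [Function.update_self, Function.update_of_ne h1]
    · simp [Function.update_of_ne h1, Function.update_of_ne h2]

/-- **The oriented plaquette variables are gauge invariant**: `u^h(∂p) = u(∂p)` for every `h : T^{(j)} → U(1)` (abelian group; the phases at the
four corners cancel around `∂p`) — so the (7.3.1)-type hypotheses `‖u(∂p) − 1‖ ≤ θ` of the small-plaquette members hold on the whole gauge orbit.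
[cite: BalabanImbrieJaffe1985, (2.7) p.303] -/
theorem plaqC_gaugeAct {j : ℕ} (h : GaugeTransf P j U1) (U : GaugeField P j U1) (x : Balaban1983to89.Site P j) (μ ν : Fin P.d) :
    plaqC (gaugeAct h U) x μ ν = plaqC U x μ ν := by
  simp only [plaqC, toC_gaugeAct, PBond.tgt]
  rw [shift_shift_comm x ν μ]
  have h1 := toC_ne_zero (h x)
  have h2 := toC_ne_zero (h (x.shift μ))
  have h3 := toC_ne_zero (h (x.shift ν))
  have h4 := toC_ne_zero (h ((x.shift μ).shift ν))
  have h5 := toC_ne_zero (U ⟨x.shift ν, μ⟩)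
  have h6 := toC_ne_zero (U ⟨x, ν⟩)
  field_simp

/-- **The covariant difference keeps its modulus under `(u, φ) ↦ (u^g, gφ)`**: `‖u^g(b)·(gφ)(b₊) − (gφ)(b₋)‖ = ‖u(b)φ(b₊) − φ(b₋)‖`
(`u^g_b = g(b₋)u_bg(b₊)^{−1}`, `|g| = 1`) — the first sum of (2.38) is invariant. [cite: BalabanImbrieJaffe1985, (2.7) p.303] -/
theorem norm_covDiff_gaugeAct {n : ℕ} (g : GaugeTransf P n U1) (v : GaugeField P n U1) (ψ : Balaban1983to89.Site P n → ℂ) (b : PBond P n) :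
    ‖toC (gaugeAct g v b) * (toC (g b.tgt) * ψ b.tgt) - toC (g b.src) * ψ b.src‖ = ‖toC (v b) * ψ b.tgt - ψ b.src‖ := by
  rw [toC_gaugeAct]
  have hne := toC_ne_zero (g b.tgt)
  have e : toC (g b.src) * toC (v b) * (toC (g b.tgt))⁻¹ * (toC (g b.tgt) * ψ b.tgt) - toC (g b.src) * ψ b.src =
      toC (g b.src) * (toC (v b) * ψ b.tgt - ψ b.src) := by
    field_simp
  rw [e, norm_mul, norm_toC, one_mul]

variable {ι : Type*} [Fintype ι] [DecidableEq ι]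

/-- kernel: **an orthogonal congruence preserves positive definiteness**: `RᵀR = 1`, `T ≻ 0 ⟹ RTRᵀ ≻ 0` (Mathlib's
`Matrix.PosDef.mul_mul_conjTranspose_same`; the change of variables of the Gaussian integral (4.9)). [cite: BalabanImbrieJaffe1988, (4.9) p.275] -/
theorem posDef_conj_orthogonal {R T : Matrix ι ι ℝ} (hR : Rᵀ * R = 1) (hT : T.PosDef) : (R * T * Rᵀ).PosDef := by
  have hu : IsUnit R := (Matrix.isUnit_iff_isUnit_det R).2 (Matrix.isUnit_det_of_left_inverse hR)
  have h := hT.mul_mul_conjTranspose_same (Matrix.vecMul_injective_of_isUnit hu)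
  rwa [Matrix.conjTranspose_eq_transpose_of_trivial] at h

/-- kernel: the (4.9) triple from positive definiteness — `T ≻ 0`, `Z49 T E N = e^{−EN}√(2π)^{|ι|}/√det T` and `Z49 T E N > 0` (r18's `Z49_eq`,
`Z49_pos`). [cite: BalabanImbrieJaffe1988, (4.9) p.275] -/
theorem z49Triple_of_posDef {T : Matrix ι ι ℝ} (hT : T.PosDef) (E N : ℝ) :
    T.PosDef ∧ Z49 T E N = Real.exp (-(E * N)) * (Real.sqrt (2 * Real.pi) ^ Fintype.card ι / Real.sqrt T.det) ∧ 0 < Z49 T E N :=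
  ⟨hT, Z49_eq T hT E N, Z49_pos T hT E N⟩

variable {S : Type*} [Fintype S] [DecidableEq S]

/-- **A unitary diagonal conjugation of the complex precision is an orthogonal congruence of the realified compressed precision**, hence
preserves positive definiteness: `realify((M_mXM_mᴴ)|_Λ) = R·realify(X|_Λ)·Rᵀ` with `R = realify(M_m|_Λ)` orthogonal (p34's
`compress_diagonal_sandwich`, `realify_conjTranspose`, `realify_orthogonal_of_unitary`). [cite: BalabanImbrieJaffe1988, (4.9) p.275] -/
theorem posDef_realify_compress_unitConj (Λ : Finset S) (m : S → U1) (X : Matrix S S ℂ) (hX : (realify (compress Λ X)).PosDef) :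
    (realify (compress Λ (diagonal (fun i => toC (m i)) * X * (diagonal (fun i => toC (m i)))ᴴ))).PosDef := by
  rw [compress_diagonal_sandwich, realify_mul, realify_mul, realify_conjTranspose]
  exact posDef_conj_orthogonal (realify_orthogonal_of_unitary (conjTranspose_mul_diagonal_toC fun x : ↥Λ => m x)) hX

/-- **`Z49` is invariant under a unitary diagonal conjugation of the complex precision** (p34's `Z49_conj_orthogonal` after the same
rewriting; no positivity needed). [cite: BalabanImbrieJaffe1988, (4.9) p.275] -/
theorem Z49_realify_compress_unitConj (Λ : Finset S) (m : S → U1) (X : Matrix S S ℂ) (E N : ℝ) :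
    Z49 (realify (compress Λ (diagonal (fun i => toC (m i)) * X * (diagonal (fun i => toC (m i)))ᴴ))) E N =
      Z49 (realify (compress Λ X)) E N := by
  rw [compress_diagonal_sandwich, realify_mul, realify_mul, realify_conjTranspose]
  exact Z49_conj_orthogonal (realify_orthogonal_of_unitary (conjTranspose_mul_diagonal_toC fun x : ↥Λ => m x)) _ E N

/-- kernel: a unitary diagonal conjugation preserves the absolute values of the entries of the inverse. [folklore] -/
private theorem norm_inv_unitConj_apply (m : S → ℂ) (hm : ∀ i, ‖m i‖ = 1) (Y : Matrix S S ℂ) (i l : S) :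
    ‖(diagonal m * Y * (diagonal m)ᴴ)⁻¹ i l‖ = ‖Y⁻¹ i l‖ := by
  have hmm : ∀ i, m i * (starRingEnd ℂ) (m i) = 1 := fun i => by
    rw [Complex.mul_conj, Complex.normSq_eq_norm_sq, hm, one_pow, Complex.ofReal_one]
  have h1 : (diagonal m)ᴴ * diagonal m = 1 := by
    rw [diagonal_conjTranspose, diagonal_mul_diagonal, ← diagonal_one]
    exact congrArg diagonal (funext fun i => by rw [Pi.star_apply, Complex.star_def, mul_comm, hmm])
  have h2 : diagonal m * (diagonal m)ᴴ = 1 := mul_eq_one_comm.1 h1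
  rw [Matrix.mul_inv_rev, Matrix.mul_inv_rev, Matrix.inv_eq_left_inv h1, Matrix.inv_eq_left_inv h2, ← Matrix.mul_assoc,
    diagonal_conjTranspose, mul_diagonal, diagonal_mul, norm_mul, norm_mul, Pi.star_apply, Complex.star_def, Complex.norm_conj, hm, hm,
    one_mul, mul_one]

/-- kernel: **the sup-norm threshold** — for `d′ ≥ 1`, `L ≥ 2`, `0 ≤ t ≤ 1/(4d′L)`: `2(L−1)L·d′·t² + 2(d′(L−1)t)² ≤ ½` (both terms `≤ 2(d′Lt)² ≤ ⅛`);
`t = L^kε|e|‖A‖_∞` is the bound of gen 21 §7 on `‖u_k(b) − 1‖` for *«exp[ie_kηA], where A is smooth and small»*.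
[cite: BalabanImbrieJaffe1985, p.326 «A is smooth and small»] -/
theorem smallness_of_sup {dr Lr t : ℝ} (hd : 1 ≤ dr) (hL : 2 ≤ Lr) (ht0 : 0 ≤ t) (ht : t ≤ 1 / (4 * dr * Lr)) :
    2 * ((Lr - 1) * Lr) * dr * t ^ 2 + 2 * (dr * (Lr - 1) * t) ^ 2 ≤ 1 / 2 := by
  have hdL : 0 < dr * Lr := by nlinarith
  have hs : dr * Lr * t ≤ 1 / 4 := by
    have h := mul_le_mul_of_nonneg_left ht hdL.le
    have e : dr * Lr * (1 / (4 * dr * Lr)) = 1 / 4 := by field_simp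
    linarith [h, e]
  have hs0 : 0 ≤ dr * Lr * t := mul_nonneg hdL.le ht0
  have hC : (dr * Lr * t) ^ 2 ≤ 1 / 16 := by nlinarith
  have hA : (Lr - 1) * Lr * dr * t ^ 2 ≤ (dr * Lr * t) ^ 2 := by
    have h3 : 0 ≤ dr * Lr - Lr + 1 := by nlinarith
    have h4 := mul_nonneg (by positivity : 0 ≤ dr * Lr * t ^ 2) h3
    nlinarith [h4]
  have hB : (dr * (Lr - 1) * t) ^ 2 ≤ (dr * Lr * t) ^ 2 := by
    have h5 : 0 ≤ dr * (Lr - 1) * t := by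
      have : 0 ≤ Lr - 1 := by linarith
      positivity
    exact pow_le_pow_left₀ h5 (by nlinarith) 2
  nlinarith [hA, hB, hC]

end Kernels

/-! ## §1 (2.38) on the gauge orbit -/

section Orbit238

/-- **THE (2.38)-SHAPE = [I] (7.3.2) FOR THE TORUS FORM `Δ_k(T_η,u^h)` ON THE GAUGE ORBIT OF A SMALL-PLAQUETTE `u`, EVERY `φ`**: the hypothesis
`‖u(∂p) − 1‖ ≤ θ` is gauge invariant (`plaqC_gaugeAct`), so gen 21's `ineq238_torus_smallPlaquette` holds at every `u^h`:
`(A/a_k)·[γ₀Σ_b‖(u^h)_k(b)φ(b₊) − φ(b₋)‖² − (4/3)d′⁴(L^{2k}θ)²Σ_y‖φ(y)‖²] ≤ Re⟨φ, Δ_k(T_η,u^h)φ⟩`. [cite: BalabanImbrieJaffe1985, (7.3.2) p.326]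
[cite: BalabanImbrieJaffe1988, (2.38) p.264] -/
theorem ineq238_torus_smallPlaquette_gaugeAct {k : ℕ} (hk1 : 1 ≤ k) (hk : 0 + k ≤ P.m + P.K) {a : ℝ} (ha : 0 < a) (U : GaugeField P 0 U1)
    {θ : ℝ} (hθ : ∀ (x : Balaban1983to89.Site P 0) (μ ν : Fin P.d), ‖plaqC U x μ ν - 1‖ ≤ θ) (h : GaugeTransf P 0 U1)
    (φ : Balaban1983to89.Site P (0 + k) → ℂ) :
    (B1RG242Torus.α P a k * (P.L : ℝ) ^ (k * P.d)) / B1.aSeq a P.L k *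
        (min (a / (9 * (P.d + 1))) (1 / 12) * ∑ b : PBond P (0 + k), ‖toC (lineIter (gaugeAct h U) k b) * φ b.tgt - φ b.src‖ ^ 2
          - 4 / 3 * (P.d : ℝ) ^ 4 * (((P.L : ℝ) ^ k) ^ 2 * θ) ^ 2 * ∑ y : Balaban1983to89.Site P (0 + k), ‖φ y‖ ^ 2)
      ≤ (star φ ⬝ᵥ (deltaRegion (B1RG242Torus.α P a k * (P.L : ℝ) ^ (k * P.d)) P.eps⁻¹ (gaugeAct h U) k univ *ᵥ φ)).re :=
  ineq238_torus_smallPlaquette hk1 hk ha (gaugeAct h U) (fun x μ ν => by rw [plaqC_gaugeAct]; exact hθ x μ ν) φ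

variable {d : ℕ}

/-- **(2.38) FOR `Δ_{k,loc}(u)`, `Ω = T_η`, AT EVERY GAUGE TRANSFORM `u = (e^{ieεA})^h` OF A (2.23)-REGULAR BACKGROUND, FOR THE PRINTED DATA WITH
BIG-BLOCK CUBES** (p. 264 (2.38); [I] p. 326 *«by change of gauge … exp[ie_kηA], where A is smooth»*).  The constants `c₀, e₁` and ALL hypotheses
of gen 21's `ineq238_regular_torus_cwt` on the representative `A` (regularity, reference box, radii, deep `Λ`); the conclusion for every
`h : T_ε → U(1)` and every `φ` supported in `Λ`:
`(A/a_k)·[γ₀·Σ_b‖(u^h)_k(b)φ(b₊) − φ(b₋)‖² − ((4/3)d′⁴(2c·e_k^β)² + a_k²c₀e^{δ₀/2}K_{d′}(δ₀/2)(m·e^{−2δ₀R/L^k} + e^{−(δ₀/2)R₁/L^k}))·Σ_y‖φ(y)‖²]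
≤ Re⟨φ, Δ_{k,loc}(u^h)φ⟩` — the rotated field `ψ = M^{(k)}_hᴴφ` has the same covariant differences (`norm_covDiff_gaugeAct`, (2.8)
`lineIter_gaugeAct`), the same `ℓ²` norm and the same form (gen 15's `form_deltaLocT_gaugeAct`). [cite: BalabanImbrieJaffe1988, (2.38) p.264]
[cite: BalabanImbrieJaffe1985, p.326 «exp[ie_kηA]»] -/
theorem ineq238_regular_torus_cwt_gaugeAct (d L : ℕ) (hL : 2 ≤ L) {a : ℝ} (ha : 0 < a) (e creg β : ℝ) (hcreg : 0 ≤ creg) (hβ : 0 < β) :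
    ∃ s₀ : ℕ, ∀ s : ℕ, s₀ ≤ s → ∃ c₀ e₁ : ℝ, 0 < c₀ ∧ 0 < e₁ ∧
      ∀ (P : Params) (hPd : P.d = d + 1), P.L = L → ∀ (k : ℕ), 1 ≤ k → k ≤ P.K → k + s ≤ P.m + P.K →
      3 * (L ^ k * L ^ s) ≤ P.sitesPerDir 0 →
      ∀ (A : PBond P 0 → ℝ) (ec : ℝ), 0 < ec → ec ≤ e₁ →
      (∀ (z : Balaban1983to89.Site P 0) (μ ν : Fin P.d),
          P.spacing k * |e| / ec * |A ⟨z.shift μ, ν⟩ - A ⟨z, ν⟩| ≤ creg * ec ^ (β - 1) / (L : ℝ) ^ k) →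
      ∀ (c M0 : Fin (d + 1) → ℕ), (∀ i, c i * P.L ^ k + P.L ^ k * M0 i ≤ P.sitesPerDir 0) →
      ∀ (sg W : ℕ), 1 ≤ sg → ∀ (R R₀ R₁ : ℝ), ((rowMargin L (d + 1) k s : ℕ) : ℝ) < R → 0 ≤ R₁ → R₁ < R₀ →
        2 * (sg : ℝ) / 3 + R₀ / 2 + R ≤ W → (∀ i, ((P.L ^ k * M0 i : ℕ) : ℝ) + R ≤ P.sitesPerDir 0) →
      ∀ (Λ : Finset (Balaban1983to89.Site P (0 + k))),
        (∀ y₁ ∈ Λ, ∀ μ, (c (Fin.cast hPd μ) : ℝ) * P.L ^ k + (R₀ + R) ≤ (P.L : ℝ) ^ k * (y₁ μ).val ∧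
          (P.L : ℝ) ^ k * (y₁ μ).val + P.L ^ k + (R₀ + R) ≤ (c (Fin.cast hPd μ) : ℝ) * P.L ^ k + (P.L : ℝ) ^ k * M0 (Fin.cast hPd μ)) →
      ∀ (h : GaugeTransf P 0 U1) (φ : Balaban1983to89.Site P (0 + k) → ℂ), (∀ y ∉ Λ, φ y = 0) →
        (B1RG242Torus.α P a k * (P.L : ℝ) ^ (k * P.d)) / B1.aSeq a P.L k *
            (min (a / (9 * (P.d + 1))) (1 / 12) *
                ∑ b : PBond P (0 + k), ‖toC (lineIter (gaugeAct h (expGauge P e A)) k b) * φ b.tgt - φ b.src‖ ^ 2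
              - (4 / 3 * (P.d : ℝ) ^ 4 * (2 * creg * ec ^ β) ^ 2 +
                  B1.aSeq a P.L k ^ 2 * (c₀ * Real.exp (1 / (8 * (L : ℝ) ^ s) / 2) * latticeConst P.d (1 / (8 * (L : ℝ) ^ s) / 2)) *
                    ((((⌊(((P.L : ℝ) ^ k) - 1 + R₀) / sg⌋₊ : ℝ) + 3) ^ (d + 1)) *
                        Real.exp (-(1 / (8 * (L : ℝ) ^ s) * (((P.L : ℝ) ^ k)⁻¹ * (2 * R)))) +
                      Real.exp (-(1 / (8 * (L : ℝ) ^ s) / 2 * (((P.L : ℝ) ^ k)⁻¹ * R₁))))) *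
                ∑ y : Balaban1983to89.Site P (0 + k), ‖φ y‖ ^ 2)
          ≤ (star φ ⬝ᵥ (deltaLocT (B1RG242Torus.α P a k * (P.L : ℝ) ^ (k * P.d)) P.eps⁻¹ (gaugeAct h (expGauge P e A)) k
              (cubeFamB hPd (P.L ^ k) c M0 sg W (L ^ k * L ^ s)) (lamFam hPd (P.L ^ k) c M0 sg)
              (cutoff R₁ R₀ (B5Ineq137Torus.T P 0)) *ᵥ φ)).re := by
  obtain ⟨s₀, H⟩ := ineq238_regular_torus_cwt d L hL ha e creg β hcreg hβ
  refine ⟨s₀, fun s hs => ?_⟩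
  obtain ⟨c₀, e₁, hc₀, he₁, M⟩ := H s hs
  refine ⟨c₀, e₁, hc₀, he₁, ?_⟩
  intro P hPd hPL k hk1 hkK hks hsize A ec hec hece hreg c M0 hfit0 sg W hsg R R₀ R₁ hRm hR₁ hR10 hW hgap Λ hΛ h φ hφ
  have hk0 : 0 + k ≤ P.m + P.K := by omega
  have hak0 : 0 < B1.aSeq a P.L k := B1.aSeq_pos ha (B1RG242Torus.one_lt_cast_L P) hk1
  have hα : 0 < B1RG242Torus.α P a k := mul_pos hak0 (inv_pos.mpr (pow_pos (P.spacing_pos k) 2))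
  have hA0 : 0 < B1RG242Torus.α P a k * (P.L : ℝ) ^ (k * P.d) := mul_pos hα (pow_pos P.cast_L_pos _)
  have hcube : ∀ α, IsBlockUnion k (cubeFamB hPd (P.L ^ k) c M0 sg W (L ^ k * L ^ s) α) := by
    rw [← hPL]; exact isBlockUnion_cubeFamB hPd hk0 c M0 sg W
  -- the rotated-back field `ψ = M^{(k)}_hᴴφ`
  obtain ⟨ψ, hψdef⟩ : ∃ ψ : Balaban1983to89.Site P (0 + k) → ℂ, ψ = fun y => (starRingEnd ℂ) (toC (h (cornerIter k y))) * φ y :=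
    ⟨_, rfl⟩
  have hφψ : ∀ y, φ y = toC (h (cornerIter k y)) * ψ y := fun y => by
    rw [hψdef, ← mul_assoc, toC_mul_conj, one_mul]
  have hφM : φ = mulOpK h k *ᵥ ψ := funext fun y => by rw [mulOpK_mulVec]; exact hφψ y
  have hψ : ∀ y ∉ Λ, ψ y = 0 := fun y hy => by rw [hψdef]; simp only [hφ y hy, mul_zero]
  have h1 : ∑ b : PBond P (0 + k), ‖toC (lineIter (gaugeAct h (expGauge P e A)) k b) * φ b.tgt - φ b.src‖ ^ 2 =
      ∑ b : PBond P (0 + k), ‖toC (lineIter (expGauge P e A) k b) * ψ b.tgt - ψ b.src‖ ^ 2 := by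
    rw [lineIter_gaugeAct h (expGauge P e A) k hk0]
    exact Finset.sum_congr rfl fun b _ => by rw [hφψ b.tgt, hφψ b.src, norm_covDiff_gaugeAct]
  have h2 : ∑ y : Balaban1983to89.Site P (0 + k), ‖φ y‖ ^ 2 = ∑ y : Balaban1983to89.Site P (0 + k), ‖ψ y‖ ^ 2 :=
    Finset.sum_congr rfl fun y _ => by rw [hφψ y, norm_mul, norm_toC, one_mul]
  have h3 : star φ ⬝ᵥ (deltaLocT (B1RG242Torus.α P a k * (P.L : ℝ) ^ (k * P.d)) P.eps⁻¹ (gaugeAct h (expGauge P e A)) k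
        (cubeFamB hPd (P.L ^ k) c M0 sg W (L ^ k * L ^ s)) (lamFam hPd (P.L ^ k) c M0 sg) (cutoff R₁ R₀ (B5Ineq137Torus.T P 0)) *ᵥ φ) =
      star ψ ⬝ᵥ (deltaLocT (B1RG242Torus.α P a k * (P.L : ℝ) ^ (k * P.d)) P.eps⁻¹ (expGauge P e A) k
        (cubeFamB hPd (P.L ^ k) c M0 sg W (L ^ k * L ^ s)) (lamFam hPd (P.L ^ k) c M0 sg) (cutoff R₁ R₀ (B5Ineq137Torus.T P 0)) *ᵥ ψ) := by
    rw [hφM]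
    exact form_deltaLocT_gaugeAct hk0 (inv_ne_zero P.eps_pos.ne') hA0 h (expGauge P e A) hcube _ _ ψ
  rw [h1, h2, h3]
  exact M P hPd hPL k hk1 hkK hks hsize A ec hec hece hreg c M0 hfit0 sg W hsg R R₀ R₁ hRm hR₁ hR10 hW hgap Λ hΛ ψ hψ

end Orbit238

/-! ## §2 (2.40) and (4.9)_{j≥1} on the gauge orbit -/

section Orbit240

variable {d : ℕ}

/-- **THE (4.16) IDENTITY `Z^{(k)}_Λ((u^h)_k) = Z^{(k)}_Λ(u_k)` IN THE `lineIter` CURRENCY** (p. 277: *"and the normalization factors Z^{(j)}_{Λ^{(j)}_{10}}(u_k).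
However, all expressions possess this invariance"*): for EVERY `U(1)` background `u`, every `h : T_ε → U(1)`, every `Λ ⊆ T^{(k)}`, every cube family
of `k`-block unions, real weights and cut-off, `κ`, `E_s`, `N` — r18's `Z49` of the realified compressed (2.40)-operator built on `Δ_{k,loc}` and
`P(u_k)`, `u_k = lineIter u k`, takes the same value at `u^h` (gen 21's `op240_deltaLocT_gaugeAct` + (2.8) `lineIter_gaugeAct`: a unitary diagonal
conjugation; p34's `Z49_conj_orthogonal`; the twin of p34's `Z49_prec49_gaugeAct`, which is stated for the corner-convention `ū_k = barUc k u`).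
No positivity or convergence hypothesis. [cite: BalabanImbrieJaffe1988, (4.9) p.275] [cite: BalabanImbrieJaffe1988, (4.16) p.276] -/
theorem Z49_deltaLocT_lineIter_gaugeAct {k : ℕ} (hk : 0 + k ≤ P.m + P.K) (hk1 : 0 + k + 1 ≤ P.m + P.K) {A c : ℝ} (hc : c ≠ 0) (hA : 0 < A)
    (κ : ℝ) (h : GaugeTransf P 0 U1) (U : GaugeField P 0 U1) {ι : Type*} [Fintype ι] {cube : ι → Finset (Balaban1983to89.Site P 0)}
    (hcube : ∀ α, IsBlockUnion k (cube α)) (lam : ι → Balaban1983to89.Site P 0 → Balaban1983to89.Site P 0 → ℝ)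
    (ζ'' : Balaban1983to89.Site P 0 → Balaban1983to89.Site P 0 → ℝ) (Λ : Finset (Balaban1983to89.Site P (0 + k))) (Es N : ℝ) :
    Z49 (realify (compress Λ (op240 (deltaLocT A c (gaugeAct h U) k cube lam ζ'') κ (lineIter (gaugeAct h U) k)))) Es N =
      Z49 (realify (compress Λ (op240 (deltaLocT A c U k cube lam ζ'') κ (lineIter U k)))) Es N := by
  have em : mulOpK h k = diagonal (fun y : Balaban1983to89.Site P (0 + k) => toC (h (cornerIter k y))) := rfl
  rw [lineIter_gaugeAct h U k hk, op240_deltaLocT_gaugeAct hk hk1 hc hA κ h U hcube lam ζ'', em]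
  exact Z49_realify_compress_unitConj Λ (fun y => h (cornerIter k y)) _ Es N

/-- **(2.40) AND (4.9)_{j≥1} FOR THE TORUS FORM ON THE GAUGE ORBIT OF A SMALL-PLAQUETTE `u`**: the constant `θ₀(d, L, a, κ̂)` and the hypotheses of
gen 21's `Z49_torus_smallPlaquette` on the representative `u` (plaquettes; averaged-field smallness `(T₁, δ′)` of `u_k = lineIter u k`, `σ = ½`),
the conclusion at `u^h` for EVERY `h : T_ε → U(1)`, every `Λ`, `E_s`, `N`: `realify((Δ_k(T,u^h) + (A/a_k)κ̂P((u^h)_k))|_Λ)` IS POSITIVE DEFINITE,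
`Z^{(k)}_Λ = e^{−E_sN}√(2π)^{2|Λ|}/√det` and `Z^{(k)}_Λ > 0` (gen 19's `op240_deltaRegion_gaugeAct`; a unitary diagonal conjugation is an orthogonal
congruence of the realified precision). [cite: BalabanImbrieJaffe1988, (2.40) p.264] [cite: BalabanImbrieJaffe1988, (4.9) p.275] -/
theorem Z49_torus_smallPlaquette_gaugeAct (d L : ℕ) (hd : 1 ≤ d) (hL2 : 2 ≤ L) {a : ℝ} (ha : 0 < a) {κ' : ℝ} (hκ' : 0 < κ') :
    ∃ θ₀ : ℝ, 0 < θ₀ ∧ ∀ (P : Params), P.d = d → P.L = L →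
      ∀ k : ℕ, 1 ≤ k → k ≤ P.K → k + 1 ≤ P.m + P.K →
      ∀ (U : GaugeField P 0 U1) (θ : ℝ), (∀ (y : Balaban1983to89.Site P 0) (μ ν : Fin P.d), ‖plaqC U y μ ν - 1‖ ≤ θ) →
        (((P.L : ℝ) ^ k) ^ 2 * θ) ^ 2 ≤ θ₀ →
      ∀ T₁ δ' : ℝ, (∀ B : PBond P (0 + k), blkIter 1 B.src = blkIter 1 B.tgt → ‖toC (lineIter U k B) - 1‖ ≤ T₁) →
        (∀ x : Balaban1983to89.Site P (0 + k), ‖holCK (lineIter U k) 1 x - 1‖ ≤ δ') →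
        2 * (((P.L : ℝ) - 1) * P.L) * P.d * T₁ ^ 2 + 2 * δ' ^ 2 ≤ 1 / 2 →
      ∀ (h : GaugeTransf P 0 U1) (Λ : Finset (Balaban1983to89.Site P (0 + k))) (Es N : ℝ),
        (realify (compress Λ (op240 (deltaRegion (B1RG242Torus.α P a k * (P.L : ℝ) ^ (k * P.d)) P.eps⁻¹ (gaugeAct h U) k univ)
          ((B1RG242Torus.α P a k * (P.L : ℝ) ^ (k * P.d)) / B1.aSeq a P.L k * κ') (lineIter (gaugeAct h U) k)))).PosDef ∧
        Z49 (realify (compress Λ (op240 (deltaRegion (B1RG242Torus.α P a k * (P.L : ℝ) ^ (k * P.d)) P.eps⁻¹ (gaugeAct h U) k univ)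
          ((B1RG242Torus.α P a k * (P.L : ℝ) ^ (k * P.d)) / B1.aSeq a P.L k * κ') (lineIter (gaugeAct h U) k)))) Es N =
          Real.exp (-(Es * N)) * (Real.sqrt (2 * Real.pi) ^ Fintype.card (↥Λ × Fin 2) /
            Real.sqrt (realify (compress Λ (op240 (deltaRegion (B1RG242Torus.α P a k * (P.L : ℝ) ^ (k * P.d)) P.eps⁻¹ (gaugeAct h U) k univ)
              ((B1RG242Torus.α P a k * (P.L : ℝ) ^ (k * P.d)) / B1.aSeq a P.L k * κ') (lineIter (gaugeAct h U) k)))).det) ∧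
        0 < Z49 (realify (compress Λ (op240 (deltaRegion (B1RG242Torus.α P a k * (P.L : ℝ) ^ (k * P.d)) P.eps⁻¹ (gaugeAct h U) k univ)
          ((B1RG242Torus.α P a k * (P.L : ℝ) ^ (k * P.d)) / B1.aSeq a P.L k * κ') (lineIter (gaugeAct h U) k)))) Es N := by
  obtain ⟨θ₀, hθ₀, H⟩ := Z49_torus_smallPlaquette d L hd hL2 ha hκ'
  refine ⟨θ₀, hθ₀, ?_⟩
  intro P hPd hPL k hk1 hkK hk' U θ hθ hτ T₁ δ' hInt hTree hσ h Λ Es N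
  have hk0 : 0 + k ≤ P.m + P.K := by omega
  have hj : 0 + k + 1 ≤ P.m + P.K := by omega
  have hak0 : 0 < B1.aSeq a P.L k := B1.aSeq_pos ha (B1RG242Torus.one_lt_cast_L P) hk1
  have hα : 0 < B1RG242Torus.α P a k := mul_pos hak0 (inv_pos.mpr (pow_pos (P.spacing_pos k) 2))
  have hA0 : 0 < B1RG242Torus.α P a k * (P.L : ℝ) ^ (k * P.d) := mul_pos hα (pow_pos P.cast_L_pos _)
  have em : mulOpK h k = diagonal (fun y : Balaban1983to89.Site P (0 + k) => toC (h (cornerIter k y))) := rfl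
  rw [lineIter_gaugeAct h U k hk0, op240_deltaRegion_gaugeAct hk0 hj (inv_ne_zero P.eps_pos.ne') hA0 _ h U _, em]
  exact z49Triple_of_posDef (posDef_realify_compress_unitConj Λ (fun y => h (cornerIter k y)) _
    (H P hPd hPL k hk1 hkK hk' U θ hθ hτ T₁ δ' hInt hTree hσ Λ Es N).1) Es N

/-- **(2.40) AND (4.9)_{j≥1} FOR `Δ_{k,loc}(u)`, `Ω = T_η`, AT EVERY GAUGE TRANSFORM `u = (e^{ieεA})^h` OF A (2.23)-REGULAR BACKGROUND, FOR THE PRINTED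
DATA WITH BIG-BLOCK CUBES, CONSTANTS CHOSEN BEFORE THE INSTANCE** (p. 264: *"by (2.38), C^{(k)}_Λ(u)^{−1} is bounded below"*; p. 275 (4.9); [I] p. 326
*«by change of gauge …»*).  The constants `e₁, θ₀, ρ₀` and ALL hypotheses of gen 21's `Z49_regular_torus_cwt_uniform` on the representative `A`
(regularity with `0 < e_k ≤ e₁`, `(2c·e_k^β)² ≤ θ₀`, reference box, radii `R ≥ rowMargin + ρ₀L^k`, `ρ₀L^k ≤ R₁ < R₀`, multiplicity `≤ M_max`, deep `Λ`,
averaged-field smallness of `(e^{ieεA})_k` with `σ = ½`); the conclusion for EVERY `h : T_ε → U(1)` and all `E_s, N`: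
`realify((Δ_{k,loc}(u^h) + (A/a_k)κ̂P((u^h)_k))|_Λ)` IS POSITIVE DEFINITE, `Z^{(k)}_Λ(u^h) = e^{−E_sN}(2π)^{#(Λ×2)/2}/√det(…)` and `Z^{(k)}_Λ(u^h) > 0`
(`op240_deltaLocT_gaugeAct`, `lineIter_gaugeAct`, `posDef_realify_compress_unitConj`). [cite: BalabanImbrieJaffe1988, (2.40) p.264]
[cite: BalabanImbrieJaffe1988, (4.9) p.275] [cite: BalabanImbrieJaffe1985, p.326 «exp[ie_kηA]»] -/
theorem Z49_regular_torus_cwt_uniform_gaugeAct (d L : ℕ) (hL : 2 ≤ L) {a : ℝ} (ha : 0 < a) (e creg β : ℝ) (hcreg : 0 ≤ creg)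
    (hβ : 0 < β) {κ' : ℝ} (hκ' : 0 < κ') (Mmax : ℕ) :
    ∃ s₀ : ℕ, ∀ s : ℕ, s₀ ≤ s → ∃ e₁ θ₀ ρ₀ : ℝ, 0 < e₁ ∧ 0 < θ₀ ∧ 0 < ρ₀ ∧
      ∀ (P : Params) (hPd : P.d = d + 1), P.L = L → ∀ (k : ℕ), 1 ≤ k → k ≤ P.K → k + s ≤ P.m + P.K → k + 1 ≤ P.m + P.K →
      3 * (L ^ k * L ^ s) ≤ P.sitesPerDir 0 →
      ∀ (A : PBond P 0 → ℝ) (ec : ℝ), 0 < ec → ec ≤ e₁ →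
      (∀ (z : Balaban1983to89.Site P 0) (μ ν : Fin P.d),
          P.spacing k * |e| / ec * |A ⟨z.shift μ, ν⟩ - A ⟨z, ν⟩| ≤ creg * ec ^ (β - 1) / (L : ℝ) ^ k) →
      (2 * creg * ec ^ β) ^ 2 ≤ θ₀ →
      ∀ (c M0 : Fin (d + 1) → ℕ), (∀ i, c i * P.L ^ k + P.L ^ k * M0 i ≤ P.sitesPerDir 0) →
      ∀ (sg W : ℕ), 1 ≤ sg → ∀ (R R₀ R₁ : ℝ), ((rowMargin L (d + 1) k s : ℕ) : ℝ) + ρ₀ * (L : ℝ) ^ k ≤ R → ρ₀ * (L : ℝ) ^ k ≤ R₁ →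
        R₁ < R₀ → ((⌊(((P.L : ℝ) ^ k) - 1 + R₀) / sg⌋₊ + 3) ^ (d + 1) ≤ Mmax) →
        2 * (sg : ℝ) / 3 + R₀ / 2 + R ≤ W → (∀ i, ((P.L ^ k * M0 i : ℕ) : ℝ) + R ≤ P.sitesPerDir 0) →
      ∀ (Λ : Finset (Balaban1983to89.Site P (0 + k))),
        (∀ y₁ ∈ Λ, ∀ μ, (c (Fin.cast hPd μ) : ℝ) * P.L ^ k + (R₀ + R) ≤ (P.L : ℝ) ^ k * (y₁ μ).val ∧
          (P.L : ℝ) ^ k * (y₁ μ).val + P.L ^ k + (R₀ + R) ≤ (c (Fin.cast hPd μ) : ℝ) * P.L ^ k + (P.L : ℝ) ^ k * M0 (Fin.cast hPd μ)) →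
      ∀ (T₁ δ' : ℝ),
        (∀ b : PBond P (0 + k), blkIter 1 b.src = blkIter 1 b.tgt → ‖toC (lineIter (expGauge P e A) k b) - 1‖ ≤ T₁) →
        (∀ y : Balaban1983to89.Site P (0 + k), ‖holCK (lineIter (expGauge P e A) k) 1 y - 1‖ ≤ δ') →
        2 * (((P.L : ℝ) - 1) * P.L) * P.d * T₁ ^ 2 + 2 * δ' ^ 2 ≤ 1 / 2 →
      ∀ (h : GaugeTransf P 0 U1) (Es N : ℝ),
        (realify (compress Λ (op240 (deltaLocT (B1RG242Torus.α P a k * (P.L : ℝ) ^ (k * P.d)) P.eps⁻¹ (gaugeAct h (expGauge P e A)) k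
            (cubeFamB hPd (P.L ^ k) c M0 sg W (L ^ k * L ^ s)) (lamFam hPd (P.L ^ k) c M0 sg) (cutoff R₁ R₀ (B5Ineq137Torus.T P 0)))
            ((B1RG242Torus.α P a k * (P.L : ℝ) ^ (k * P.d)) / B1.aSeq a P.L k * κ') (lineIter (gaugeAct h (expGauge P e A)) k)))).PosDef ∧
        Z49 (realify (compress Λ (op240 (deltaLocT (B1RG242Torus.α P a k * (P.L : ℝ) ^ (k * P.d)) P.eps⁻¹ (gaugeAct h (expGauge P e A)) k
            (cubeFamB hPd (P.L ^ k) c M0 sg W (L ^ k * L ^ s)) (lamFam hPd (P.L ^ k) c M0 sg) (cutoff R₁ R₀ (B5Ineq137Torus.T P 0)))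
            ((B1RG242Torus.α P a k * (P.L : ℝ) ^ (k * P.d)) / B1.aSeq a P.L k * κ') (lineIter (gaugeAct h (expGauge P e A)) k)))) Es N =
          Real.exp (-(Es * N)) * (Real.sqrt (2 * Real.pi) ^ Fintype.card (↥Λ × Fin 2) /
            Real.sqrt (realify (compress Λ (op240 (deltaLocT (B1RG242Torus.α P a k * (P.L : ℝ) ^ (k * P.d)) P.eps⁻¹ (gaugeAct h (expGauge P e A)) k
            (cubeFamB hPd (P.L ^ k) c M0 sg W (L ^ k * L ^ s)) (lamFam hPd (P.L ^ k) c M0 sg) (cutoff R₁ R₀ (B5Ineq137Torus.T P 0)))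
            ((B1RG242Torus.α P a k * (P.L : ℝ) ^ (k * P.d)) / B1.aSeq a P.L k * κ') (lineIter (gaugeAct h (expGauge P e A)) k)))).det) ∧
        0 < Z49 (realify (compress Λ (op240 (deltaLocT (B1RG242Torus.α P a k * (P.L : ℝ) ^ (k * P.d)) P.eps⁻¹ (gaugeAct h (expGauge P e A)) k
            (cubeFamB hPd (P.L ^ k) c M0 sg W (L ^ k * L ^ s)) (lamFam hPd (P.L ^ k) c M0 sg) (cutoff R₁ R₀ (B5Ineq137Torus.T P 0)))
            ((B1RG242Torus.α P a k * (P.L : ℝ) ^ (k * P.d)) / B1.aSeq a P.L k * κ') (lineIter (gaugeAct h (expGauge P e A)) k)))) Es N := by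
  obtain ⟨s₀, H⟩ := Z49_regular_torus_cwt_uniform d L hL ha e creg β hcreg hβ hκ' Mmax
  refine ⟨s₀, fun s hs => ?_⟩
  obtain ⟨e₁, θ₀, ρ₀, he₁, hθ₀, hρ₀, M⟩ := H s hs
  refine ⟨e₁, θ₀, ρ₀, he₁, hθ₀, hρ₀, ?_⟩
  intro P hPd hPL k hk1 hkK hks hk' hsize A ec hec hece hreg hθ c M0 hfit0 sg W hsg R R₀ R₁ hRρ hR₁ρ hR10 hMm hW hgap Λ hΛ T₁ δ'
    hInt hTree hσ h Es N
  have hk0 : 0 + k ≤ P.m + P.K := by omega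
  have hj : 0 + k + 1 ≤ P.m + P.K := by omega
  have hak0 : 0 < B1.aSeq a P.L k := B1.aSeq_pos ha (B1RG242Torus.one_lt_cast_L P) hk1
  have hα : 0 < B1RG242Torus.α P a k := mul_pos hak0 (inv_pos.mpr (pow_pos (P.spacing_pos k) 2))
  have hA0 : 0 < B1RG242Torus.α P a k * (P.L : ℝ) ^ (k * P.d) := mul_pos hα (pow_pos P.cast_L_pos _)
  have hcube : ∀ α, IsBlockUnion k (cubeFamB hPd (P.L ^ k) c M0 sg W (L ^ k * L ^ s) α) := by
    rw [← hPL]; exact isBlockUnion_cubeFamB hPd hk0 c M0 sg W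
  have em : mulOpK h k = diagonal (fun y : Balaban1983to89.Site P (0 + k) => toC (h (cornerIter k y))) := rfl
  rw [lineIter_gaugeAct h (expGauge P e A) k hk0, op240_deltaLocT_gaugeAct hk0 hj (inv_ne_zero P.eps_pos.ne') hA0 _ h _ hcube, em]
  exact z49Triple_of_posDef (posDef_realify_compress_unitConj Λ (fun y => h (cornerIter k y)) _
    (M P hPd hPL k hk1 hkK hks hk' hsize A ec hec hece hreg hθ c M0 hfit0 sg W hsg R R₀ R₁ hRρ hR₁ρ hR10 hMm hW hgap Λ hΛ T₁ δ' hInt hTree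
      hσ Es N).1) Es N

end Orbit240

/-! ## §3 (2.41) on the gauge orbit, constants chosen before the instance -/

section Orbit241

variable {d : ℕ}

/-- **(2.41) FOR `C^{(k)}_Λ(u) = [(Δ_{k,loc}(u) + (A/a_k)κ̂P(u_k))|_Λ]^{−1}` AT EVERY GAUGE TRANSFORM `u = (e^{ieεA})^h` OF A (2.23)-REGULAR BACKGROUND,
`Ω = T_η`, FOR THE PRINTED DATA WITH BIG-BLOCK CUBES, CONSTANTS CHOSEN BEFORE THE INSTANCE** (p. 264 (2.41); [I] p. 326 *«by change of gauge
u_k can be transformed … into a configuration of the form exp[ie_kηA], where A is smooth and small»*).  The constants `e₁ θ₀ ρ₀ δ₁ c₂` and ALL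
hypotheses of gen 21's `decay241_regular_torus_cwt_uniform` on the representative `A`; the conclusion for EVERY `h : T_ε → U(1)` and all
`x₁, x₂ ∈ Λ`: **`‖C^{(k)}_Λ(u^h; x₁, x₂)‖ ≤ (a_k/A)·c₂·e^{−δ₁|x₁−x₂|_{T^{(k)}}}`** (the diagonal unitary conjugation `M^{(k)}_h` keeps the absolute
values of the kernel of the inverse). [cite: BalabanImbrieJaffe1988, (2.41) p.264] [cite: BalabanImbrieJaffe1985, p.326 «exp[ie_kηA]»] -/
theorem decay241_regular_torus_cwt_uniform_gaugeAct (d L : ℕ) (hL : 2 ≤ L) {a : ℝ} (ha : 0 < a) (e creg β : ℝ) (hcreg : 0 ≤ creg)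
    (hβ : 0 < β) {κ' : ℝ} (hκ' : 0 < κ') (Mmax : ℕ) :
    ∃ s₀ : ℕ, ∀ s : ℕ, s₀ ≤ s → ∃ e₁ θ₀ ρ₀ δ₁ c₂ : ℝ, 0 < e₁ ∧ 0 < θ₀ ∧ 0 < ρ₀ ∧ 0 < δ₁ ∧ 0 < c₂ ∧
      ∀ (P : Params) (hPd : P.d = d + 1), P.L = L → ∀ (k : ℕ), 1 ≤ k → k ≤ P.K → k + s ≤ P.m + P.K → k + 1 ≤ P.m + P.K →
      3 * (L ^ k * L ^ s) ≤ P.sitesPerDir 0 →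
      ∀ (A : PBond P 0 → ℝ) (ec : ℝ), 0 < ec → ec ≤ e₁ →
      (∀ (z : Balaban1983to89.Site P 0) (μ ν : Fin P.d),
          P.spacing k * |e| / ec * |A ⟨z.shift μ, ν⟩ - A ⟨z, ν⟩| ≤ creg * ec ^ (β - 1) / (L : ℝ) ^ k) →
      (2 * creg * ec ^ β) ^ 2 ≤ θ₀ →
      ∀ (c M0 : Fin (d + 1) → ℕ), (∀ i, c i * P.L ^ k + P.L ^ k * M0 i ≤ P.sitesPerDir 0) →
      ∀ (sg W : ℕ), 1 ≤ sg → ∀ (R R₀ R₁ : ℝ), ((rowMargin L (d + 1) k s : ℕ) : ℝ) + ρ₀ * (L : ℝ) ^ k ≤ R → ρ₀ * (L : ℝ) ^ k ≤ R₁ →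
        R₁ < R₀ → ((⌊(((P.L : ℝ) ^ k) - 1 + R₀) / sg⌋₊ + 3) ^ (d + 1) ≤ Mmax) →
        2 * (sg : ℝ) / 3 + R₀ / 2 + R ≤ W → (∀ i, ((P.L ^ k * M0 i : ℕ) : ℝ) + R ≤ P.sitesPerDir 0) →
      ∀ (Λ : Finset (Balaban1983to89.Site P (0 + k))),
        (∀ y₁ ∈ Λ, ∀ μ, (c (Fin.cast hPd μ) : ℝ) * P.L ^ k + (R₀ + R) ≤ (P.L : ℝ) ^ k * (y₁ μ).val ∧
          (P.L : ℝ) ^ k * (y₁ μ).val + P.L ^ k + (R₀ + R) ≤ (c (Fin.cast hPd μ) : ℝ) * P.L ^ k + (P.L : ℝ) ^ k * M0 (Fin.cast hPd μ)) →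
      ∀ (T₁ δ' : ℝ),
        (∀ b : PBond P (0 + k), blkIter 1 b.src = blkIter 1 b.tgt → ‖toC (lineIter (expGauge P e A) k b) - 1‖ ≤ T₁) →
        (∀ y : Balaban1983to89.Site P (0 + k), ‖holCK (lineIter (expGauge P e A) k) 1 y - 1‖ ≤ δ') →
        2 * (((P.L : ℝ) - 1) * P.L) * P.d * T₁ ^ 2 + 2 * δ' ^ 2 ≤ 1 / 2 →
      ∀ (h : GaugeTransf P 0 U1) (x₁ x₂ : ↥Λ),
        ‖(compress Λ (op240 (deltaLocT (B1RG242Torus.α P a k * (P.L : ℝ) ^ (k * P.d)) P.eps⁻¹ (gaugeAct h (expGauge P e A)) k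
            (cubeFamB hPd (P.L ^ k) c M0 sg W (L ^ k * L ^ s)) (lamFam hPd (P.L ^ k) c M0 sg) (cutoff R₁ R₀ (B5Ineq137Torus.T P 0)))
            ((B1RG242Torus.α P a k * (P.L : ℝ) ^ (k * P.d)) / B1.aSeq a P.L k * κ') (lineIter (gaugeAct h (expGauge P e A)) k)))⁻¹ x₁ x₂‖ ≤
          ((B1RG242Torus.α P a k * (P.L : ℝ) ^ (k * P.d)) / B1.aSeq a P.L k)⁻¹ * c₂ *
            Real.exp (-(δ₁ * B5Ineq137Torus.T P (0 + k) x₁ x₂)) := by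
  obtain ⟨s₀, H⟩ := decay241_regular_torus_cwt_uniform d L hL ha e creg β hcreg hβ hκ' Mmax
  refine ⟨s₀, fun s hs => ?_⟩
  obtain ⟨e₁, θ₀, ρ₀, δ₁, c₂, he₁, hθ₀, hρ₀, hδ₁, hc₂, M⟩ := H s hs
  refine ⟨e₁, θ₀, ρ₀, δ₁, c₂, he₁, hθ₀, hρ₀, hδ₁, hc₂, ?_⟩
  intro P hPd hPL k hk1 hkK hks hk' hsize A ec hec hece hreg hθ c M0 hfit0 sg W hsg R R₀ R₁ hRρ hR₁ρ hR10 hMm hW hgap Λ hΛ T₁ δ'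
    hInt hTree hσ h x₁ x₂
  have hk0 : 0 + k ≤ P.m + P.K := by omega
  have hj : 0 + k + 1 ≤ P.m + P.K := by omega
  have hak0 : 0 < B1.aSeq a P.L k := B1.aSeq_pos ha (B1RG242Torus.one_lt_cast_L P) hk1
  have hα : 0 < B1RG242Torus.α P a k := mul_pos hak0 (inv_pos.mpr (pow_pos (P.spacing_pos k) 2))
  have hA0 : 0 < B1RG242Torus.α P a k * (P.L : ℝ) ^ (k * P.d) := mul_pos hα (pow_pos P.cast_L_pos _)
  have hcube : ∀ α, IsBlockUnion k (cubeFamB hPd (P.L ^ k) c M0 sg W (L ^ k * L ^ s) α) := by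
    rw [← hPL]; exact isBlockUnion_cubeFamB hPd hk0 c M0 sg W
  have em : mulOpK h k = diagonal (fun y : Balaban1983to89.Site P (0 + k) => toC (h (cornerIter k y))) := rfl
  rw [lineIter_gaugeAct h (expGauge P e A) k hk0, op240_deltaLocT_gaugeAct hk0 hj (inv_ne_zero P.eps_pos.ne') hA0 _ h _ hcube, em,
    compress_diagonal_sandwich, norm_inv_unitConj_apply _ (fun i => norm_toC _)]
  exact M P hPd hPL k hk1 hkK hks hk' hsize A ec hec hece hreg hθ c M0 hfit0 sg W hsg R R₀ R₁ hRρ hR₁ρ hR10 hMm hW hgap Λ hΛ T₁ δ' hInt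
    hTree hσ x₁ x₂

end Orbit241

/-! ## §4 The averaged-field smallness from ONE sup-norm threshold on `A` (*«A is smooth and small»*) -/

section SupThreshold

variable {d : ℕ}

/-- kernel: the `σ = ½` averaged-field smallness of `u_k = ((e^{ieεA})_k)` from `|A| ≤ A_∞` and `L^kε|e|A_∞ ≤ 1/(4d′L)` (gen 21 §7:
`‖u_k(b) − 1‖ ≤ L^kε|e|A_∞ =: T₁`, `‖u_k(Γ_{yx}) − 1‖ ≤ d′(L−1)T₁`; `smallness_of_sup`). [cite: BalabanImbrieJaffe1985, p.326 «A is smooth and small»] -/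
theorem smallness454_of_sup (hPd : P.d = d + 1) {L : ℕ} (hPL : P.L = L) (hL : 2 ≤ L) {k : ℕ} (hk : 0 + k ≤ P.m + P.K) (e : ℝ)
    {A : PBond P 0 → ℝ} {Asup : ℝ} (hsup : ∀ b, |A b| ≤ Asup) (hAs : P.spacing k * |e| * Asup ≤ 1 / (4 * ((d : ℝ) + 1) * L)) :
    (∀ b : PBond P (0 + k), blkIter 1 b.src = blkIter 1 b.tgt →
        ‖toC (lineIter (expGauge P e A) k b) - 1‖ ≤ P.spacing k * |e| * Asup) ∧
      (∀ y : Balaban1983to89.Site P (0 + k),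
        ‖holCK (lineIter (expGauge P e A) k) 1 y - 1‖ ≤ P.d * ((P.L : ℝ) - 1) * (P.spacing k * |e| * Asup)) ∧
      2 * (((P.L : ℝ) - 1) * P.L) * P.d * (P.spacing k * |e| * Asup) ^ 2 +
          2 * (P.d * ((P.L : ℝ) - 1) * (P.spacing k * |e| * Asup)) ^ 2 ≤ 1 / 2 := by
  have hdr : (P.d : ℝ) = (d : ℝ) + 1 := by rw [hPd]; push_cast; ring
  have hLr : (P.L : ℝ) = L := by rw [hPL]
  have hAs0 : 0 ≤ Asup := (abs_nonneg _).trans (hsup ⟨default, ⟨0, P.hd⟩⟩)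
  have ht0 : 0 ≤ P.spacing k * |e| * Asup := mul_nonneg (mul_nonneg (P.spacing_pos k).le (abs_nonneg e)) hAs0
  refine ⟨fun b _ => norm_toC_lineIter_expGauge_sub_one_le hk e hsup b,
    norm_holCK_one_sub_one_le (lineIter (expGauge P e A) k) (fun b => norm_toC_lineIter_expGauge_sub_one_le hk e hsup b), ?_⟩
  have h := smallness_of_sup (dr := (P.d : ℝ)) (Lr := (P.L : ℝ)) (by rw [hdr]; linarith [(Nat.cast_nonneg d : (0 : ℝ) ≤ d)])
    (by rw [hLr]; exact_mod_cast hL) ht0 (by rw [hdr, hLr]; exact hAs)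
  linarith [h]

/-- **(2.40) AND (4.9)_{j≥1} FOR `Δ_{k,loc}(e^{ieεA})` AT A (2.23)-REGULAR `A` WITH `L^kε|e|‖A‖_∞ ≤ 1/(4d′L)`, CONSTANTS CHOSEN BEFORE THE INSTANCE** —
gen 21's `Z49_regular_torus_cwt_uniform` with its averaged-field smallness `(T₁, δ′, σ = ½)` DISCHARGED by the single sup-norm threshold on the
representative (*«exp[ie_kηA], where A is smooth and small»*, [I] p. 326): same `e₁ θ₀ ρ₀`, same data; for all `E_s, N` the realified precision is
positive definite, `Z^{(k)}_Λ` has the closed form and is `> 0`. [cite: BalabanImbrieJaffe1988, (2.40) p.264] [cite: BalabanImbrieJaffe1988, (4.9) p.275]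
[cite: BalabanImbrieJaffe1985, p.326 «A is smooth and small»] -/
theorem Z49_regular_torus_cwt_uniform_of_sup (d L : ℕ) (hL : 2 ≤ L) {a : ℝ} (ha : 0 < a) (e creg β : ℝ) (hcreg : 0 ≤ creg)
    (hβ : 0 < β) {κ' : ℝ} (hκ' : 0 < κ') (Mmax : ℕ) :
    ∃ s₀ : ℕ, ∀ s : ℕ, s₀ ≤ s → ∃ e₁ θ₀ ρ₀ : ℝ, 0 < e₁ ∧ 0 < θ₀ ∧ 0 < ρ₀ ∧
      ∀ (P : Params) (hPd : P.d = d + 1), P.L = L → ∀ (k : ℕ), 1 ≤ k → k ≤ P.K → k + s ≤ P.m + P.K → k + 1 ≤ P.m + P.K →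
      3 * (L ^ k * L ^ s) ≤ P.sitesPerDir 0 →
      ∀ (A : PBond P 0 → ℝ) (ec : ℝ), 0 < ec → ec ≤ e₁ →
      (∀ (z : Balaban1983to89.Site P 0) (μ ν : Fin P.d),
          P.spacing k * |e| / ec * |A ⟨z.shift μ, ν⟩ - A ⟨z, ν⟩| ≤ creg * ec ^ (β - 1) / (L : ℝ) ^ k) →
      (2 * creg * ec ^ β) ^ 2 ≤ θ₀ →
      ∀ (Asup : ℝ), (∀ b, |A b| ≤ Asup) → P.spacing k * |e| * Asup ≤ 1 / (4 * ((d : ℝ) + 1) * L) →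
      ∀ (c M0 : Fin (d + 1) → ℕ), (∀ i, c i * P.L ^ k + P.L ^ k * M0 i ≤ P.sitesPerDir 0) →
      ∀ (sg W : ℕ), 1 ≤ sg → ∀ (R R₀ R₁ : ℝ), ((rowMargin L (d + 1) k s : ℕ) : ℝ) + ρ₀ * (L : ℝ) ^ k ≤ R → ρ₀ * (L : ℝ) ^ k ≤ R₁ →
        R₁ < R₀ → ((⌊(((P.L : ℝ) ^ k) - 1 + R₀) / sg⌋₊ + 3) ^ (d + 1) ≤ Mmax) →
        2 * (sg : ℝ) / 3 + R₀ / 2 + R ≤ W → (∀ i, ((P.L ^ k * M0 i : ℕ) : ℝ) + R ≤ P.sitesPerDir 0) →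
      ∀ (Λ : Finset (Balaban1983to89.Site P (0 + k))),
        (∀ y₁ ∈ Λ, ∀ μ, (c (Fin.cast hPd μ) : ℝ) * P.L ^ k + (R₀ + R) ≤ (P.L : ℝ) ^ k * (y₁ μ).val ∧
          (P.L : ℝ) ^ k * (y₁ μ).val + P.L ^ k + (R₀ + R) ≤ (c (Fin.cast hPd μ) : ℝ) * P.L ^ k + (P.L : ℝ) ^ k * M0 (Fin.cast hPd μ)) →
      ∀ (Es N : ℝ),
        (realify (compress Λ (op240 (deltaLocT (B1RG242Torus.α P a k * (P.L : ℝ) ^ (k * P.d)) P.eps⁻¹ (expGauge P e A) k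
            (cubeFamB hPd (P.L ^ k) c M0 sg W (L ^ k * L ^ s)) (lamFam hPd (P.L ^ k) c M0 sg) (cutoff R₁ R₀ (B5Ineq137Torus.T P 0)))
            ((B1RG242Torus.α P a k * (P.L : ℝ) ^ (k * P.d)) / B1.aSeq a P.L k * κ') (lineIter (expGauge P e A) k)))).PosDef ∧
        Z49 (realify (compress Λ (op240 (deltaLocT (B1RG242Torus.α P a k * (P.L : ℝ) ^ (k * P.d)) P.eps⁻¹ (expGauge P e A) k
            (cubeFamB hPd (P.L ^ k) c M0 sg W (L ^ k * L ^ s)) (lamFam hPd (P.L ^ k) c M0 sg) (cutoff R₁ R₀ (B5Ineq137Torus.T P 0)))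
            ((B1RG242Torus.α P a k * (P.L : ℝ) ^ (k * P.d)) / B1.aSeq a P.L k * κ') (lineIter (expGauge P e A) k)))) Es N =
          Real.exp (-(Es * N)) * (Real.sqrt (2 * Real.pi) ^ Fintype.card (↥Λ × Fin 2) /
            Real.sqrt (realify (compress Λ (op240 (deltaLocT (B1RG242Torus.α P a k * (P.L : ℝ) ^ (k * P.d)) P.eps⁻¹ (expGauge P e A) k
            (cubeFamB hPd (P.L ^ k) c M0 sg W (L ^ k * L ^ s)) (lamFam hPd (P.L ^ k) c M0 sg) (cutoff R₁ R₀ (B5Ineq137Torus.T P 0)))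
            ((B1RG242Torus.α P a k * (P.L : ℝ) ^ (k * P.d)) / B1.aSeq a P.L k * κ') (lineIter (expGauge P e A) k)))).det) ∧
        0 < Z49 (realify (compress Λ (op240 (deltaLocT (B1RG242Torus.α P a k * (P.L : ℝ) ^ (k * P.d)) P.eps⁻¹ (expGauge P e A) k
            (cubeFamB hPd (P.L ^ k) c M0 sg W (L ^ k * L ^ s)) (lamFam hPd (P.L ^ k) c M0 sg) (cutoff R₁ R₀ (B5Ineq137Torus.T P 0)))
            ((B1RG242Torus.α P a k * (P.L : ℝ) ^ (k * P.d)) / B1.aSeq a P.L k * κ') (lineIter (expGauge P e A) k)))) Es N := by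
  obtain ⟨s₀, H⟩ := Z49_regular_torus_cwt_uniform d L hL ha e creg β hcreg hβ hκ' Mmax
  refine ⟨s₀, fun s hs => ?_⟩
  obtain ⟨e₁, θ₀, ρ₀, he₁, hθ₀, hρ₀, M⟩ := H s hs
  refine ⟨e₁, θ₀, ρ₀, he₁, hθ₀, hρ₀, ?_⟩
  intro P hPd hPL k hk1 hkK hks hk' hsize A ec hec hece hreg hθ Asup hsup hAs c M0 hfit0 sg W hsg R R₀ R₁ hRρ hR₁ρ hR10 hMm hW hgap Λ hΛ
    Es N
  obtain ⟨hInt, hTree, hσ⟩ := smallness454_of_sup hPd hPL hL (by omega) e hsup hAs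
  exact M P hPd hPL k hk1 hkK hks hk' hsize A ec hec hece hreg hθ c M0 hfit0 sg W hsg R R₀ R₁ hRρ hR₁ρ hR10 hMm hW hgap Λ hΛ _ _ hInt hTree
    hσ Es N

/-- **(2.41) FOR `C^{(k)}_Λ(e^{ieεA})` AT A (2.23)-REGULAR `A` WITH `L^kε|e|‖A‖_∞ ≤ 1/(4d′L)`, CONSTANTS CHOSEN BEFORE THE INSTANCE** — gen 21's
`decay241_regular_torus_cwt_uniform` with `(T₁, δ′, σ = ½)` DISCHARGED by the sup-norm threshold: same `e₁ θ₀ ρ₀ δ₁ c₂`, same data;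
**`‖C^{(k)}_Λ(u; x₁, x₂)‖ ≤ (a_k/A)·c₂·e^{−δ₁|x₁−x₂|_{T^{(k)}}}`**, `u = e^{ieεA}`. [cite: BalabanImbrieJaffe1988, (2.41) p.264]
[cite: BalabanImbrieJaffe1985, p.326 «A is smooth and small»] -/
theorem decay241_regular_torus_cwt_uniform_of_sup (d L : ℕ) (hL : 2 ≤ L) {a : ℝ} (ha : 0 < a) (e creg β : ℝ) (hcreg : 0 ≤ creg)
    (hβ : 0 < β) {κ' : ℝ} (hκ' : 0 < κ') (Mmax : ℕ) :
    ∃ s₀ : ℕ, ∀ s : ℕ, s₀ ≤ s → ∃ e₁ θ₀ ρ₀ δ₁ c₂ : ℝ, 0 < e₁ ∧ 0 < θ₀ ∧ 0 < ρ₀ ∧ 0 < δ₁ ∧ 0 < c₂ ∧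
      ∀ (P : Params) (hPd : P.d = d + 1), P.L = L → ∀ (k : ℕ), 1 ≤ k → k ≤ P.K → k + s ≤ P.m + P.K → k + 1 ≤ P.m + P.K →
      3 * (L ^ k * L ^ s) ≤ P.sitesPerDir 0 →
      ∀ (A : PBond P 0 → ℝ) (ec : ℝ), 0 < ec → ec ≤ e₁ →
      (∀ (z : Balaban1983to89.Site P 0) (μ ν : Fin P.d),
          P.spacing k * |e| / ec * |A ⟨z.shift μ, ν⟩ - A ⟨z, ν⟩| ≤ creg * ec ^ (β - 1) / (L : ℝ) ^ k) →
      (2 * creg * ec ^ β) ^ 2 ≤ θ₀ →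
      ∀ (Asup : ℝ), (∀ b, |A b| ≤ Asup) → P.spacing k * |e| * Asup ≤ 1 / (4 * ((d : ℝ) + 1) * L) →
      ∀ (c M0 : Fin (d + 1) → ℕ), (∀ i, c i * P.L ^ k + P.L ^ k * M0 i ≤ P.sitesPerDir 0) →
      ∀ (sg W : ℕ), 1 ≤ sg → ∀ (R R₀ R₁ : ℝ), ((rowMargin L (d + 1) k s : ℕ) : ℝ) + ρ₀ * (L : ℝ) ^ k ≤ R → ρ₀ * (L : ℝ) ^ k ≤ R₁ →
        R₁ < R₀ → ((⌊(((P.L : ℝ) ^ k) - 1 + R₀) / sg⌋₊ + 3) ^ (d + 1) ≤ Mmax) →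
        2 * (sg : ℝ) / 3 + R₀ / 2 + R ≤ W → (∀ i, ((P.L ^ k * M0 i : ℕ) : ℝ) + R ≤ P.sitesPerDir 0) →
      ∀ (Λ : Finset (Balaban1983to89.Site P (0 + k))),
        (∀ y₁ ∈ Λ, ∀ μ, (c (Fin.cast hPd μ) : ℝ) * P.L ^ k + (R₀ + R) ≤ (P.L : ℝ) ^ k * (y₁ μ).val ∧
          (P.L : ℝ) ^ k * (y₁ μ).val + P.L ^ k + (R₀ + R) ≤ (c (Fin.cast hPd μ) : ℝ) * P.L ^ k + (P.L : ℝ) ^ k * M0 (Fin.cast hPd μ)) →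
      ∀ (x₁ x₂ : ↥Λ),
        ‖(compress Λ (op240 (deltaLocT (B1RG242Torus.α P a k * (P.L : ℝ) ^ (k * P.d)) P.eps⁻¹ (expGauge P e A) k
            (cubeFamB hPd (P.L ^ k) c M0 sg W (L ^ k * L ^ s)) (lamFam hPd (P.L ^ k) c M0 sg) (cutoff R₁ R₀ (B5Ineq137Torus.T P 0)))
            ((B1RG242Torus.α P a k * (P.L : ℝ) ^ (k * P.d)) / B1.aSeq a P.L k * κ') (lineIter (expGauge P e A) k)))⁻¹ x₁ x₂‖ ≤
          ((B1RG242Torus.α P a k * (P.L : ℝ) ^ (k * P.d)) / B1.aSeq a P.L k)⁻¹ * c₂ *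
            Real.exp (-(δ₁ * B5Ineq137Torus.T P (0 + k) x₁ x₂)) := by
  obtain ⟨s₀, H⟩ := decay241_regular_torus_cwt_uniform d L hL ha e creg β hcreg hβ hκ' Mmax
  refine ⟨s₀, fun s hs => ?_⟩
  obtain ⟨e₁, θ₀, ρ₀, δ₁, c₂, he₁, hθ₀, hρ₀, hδ₁, hc₂, M⟩ := H s hs
  refine ⟨e₁, θ₀, ρ₀, δ₁, c₂, he₁, hθ₀, hρ₀, hδ₁, hc₂, ?_⟩
  intro P hPd hPL k hk1 hkK hks hk' hsize A ec hec hece hreg hθ Asup hsup hAs c M0 hfit0 sg W hsg R R₀ R₁ hRρ hR₁ρ hR10 hMm hW hgap Λ hΛ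
    x₁ x₂
  obtain ⟨hInt, hTree, hσ⟩ := smallness454_of_sup hPd hPL hL (by omega) e hsup hAs
  exact M P hPd hPL k hk1 hkK hks hk' hsize A ec hec hece hreg hθ c M0 hfit0 sg W hsg R R₀ R₁ hRρ hR₁ρ hR10 hMm hW hgap Λ hΛ _ _ hInt hTree
    hσ x₁ x₂

/-- **(2.40) AND (4.9)_{j≥1} ON THE WHOLE GAUGE ORBIT OF A (2.23)-REGULAR, SUP-SMALL `A`** — the print-level form of [I] p. 326 *«by change of gauge
u_k can be transformed … into a configuration of the form exp[ie_kηA], where A is smooth and small»*: hypotheses on the representative `A` only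
(regular with `0 < e_k ≤ e₁`, `(2c·e_k^β)² ≤ θ₀`, `L^kε|e|‖A‖_∞ ≤ 1/(4d′L)`), data as in gen 21; conclusion at `u = (e^{ieεA})^h` for EVERY `h`:
positive definiteness, closed form and positivity of `Z^{(k)}_Λ(u)`. [cite: BalabanImbrieJaffe1988, (2.40) p.264] [cite: BalabanImbrieJaffe1988, (4.9) p.275]
[cite: BalabanImbrieJaffe1985, p.326 «exp[ie_kηA]»] -/
theorem Z49_regular_torus_cwt_uniform_gaugeAct_of_sup (d L : ℕ) (hL : 2 ≤ L) {a : ℝ} (ha : 0 < a) (e creg β : ℝ) (hcreg : 0 ≤ creg)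
    (hβ : 0 < β) {κ' : ℝ} (hκ' : 0 < κ') (Mmax : ℕ) :
    ∃ s₀ : ℕ, ∀ s : ℕ, s₀ ≤ s → ∃ e₁ θ₀ ρ₀ : ℝ, 0 < e₁ ∧ 0 < θ₀ ∧ 0 < ρ₀ ∧
      ∀ (P : Params) (hPd : P.d = d + 1), P.L = L → ∀ (k : ℕ), 1 ≤ k → k ≤ P.K → k + s ≤ P.m + P.K → k + 1 ≤ P.m + P.K →
      3 * (L ^ k * L ^ s) ≤ P.sitesPerDir 0 →
      ∀ (A : PBond P 0 → ℝ) (ec : ℝ), 0 < ec → ec ≤ e₁ →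
      (∀ (z : Balaban1983to89.Site P 0) (μ ν : Fin P.d),
          P.spacing k * |e| / ec * |A ⟨z.shift μ, ν⟩ - A ⟨z, ν⟩| ≤ creg * ec ^ (β - 1) / (L : ℝ) ^ k) →
      (2 * creg * ec ^ β) ^ 2 ≤ θ₀ →
      ∀ (Asup : ℝ), (∀ b, |A b| ≤ Asup) → P.spacing k * |e| * Asup ≤ 1 / (4 * ((d : ℝ) + 1) * L) →
      ∀ (c M0 : Fin (d + 1) → ℕ), (∀ i, c i * P.L ^ k + P.L ^ k * M0 i ≤ P.sitesPerDir 0) →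
      ∀ (sg W : ℕ), 1 ≤ sg → ∀ (R R₀ R₁ : ℝ), ((rowMargin L (d + 1) k s : ℕ) : ℝ) + ρ₀ * (L : ℝ) ^ k ≤ R → ρ₀ * (L : ℝ) ^ k ≤ R₁ →
        R₁ < R₀ → ((⌊(((P.L : ℝ) ^ k) - 1 + R₀) / sg⌋₊ + 3) ^ (d + 1) ≤ Mmax) →
        2 * (sg : ℝ) / 3 + R₀ / 2 + R ≤ W → (∀ i, ((P.L ^ k * M0 i : ℕ) : ℝ) + R ≤ P.sitesPerDir 0) →
      ∀ (Λ : Finset (Balaban1983to89.Site P (0 + k))),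
        (∀ y₁ ∈ Λ, ∀ μ, (c (Fin.cast hPd μ) : ℝ) * P.L ^ k + (R₀ + R) ≤ (P.L : ℝ) ^ k * (y₁ μ).val ∧
          (P.L : ℝ) ^ k * (y₁ μ).val + P.L ^ k + (R₀ + R) ≤ (c (Fin.cast hPd μ) : ℝ) * P.L ^ k + (P.L : ℝ) ^ k * M0 (Fin.cast hPd μ)) →
      ∀ (h : GaugeTransf P 0 U1) (Es N : ℝ),
        (realify (compress Λ (op240 (deltaLocT (B1RG242Torus.α P a k * (P.L : ℝ) ^ (k * P.d)) P.eps⁻¹ (gaugeAct h (expGauge P e A)) k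
            (cubeFamB hPd (P.L ^ k) c M0 sg W (L ^ k * L ^ s)) (lamFam hPd (P.L ^ k) c M0 sg) (cutoff R₁ R₀ (B5Ineq137Torus.T P 0)))
            ((B1RG242Torus.α P a k * (P.L : ℝ) ^ (k * P.d)) / B1.aSeq a P.L k * κ') (lineIter (gaugeAct h (expGauge P e A)) k)))).PosDef ∧
        Z49 (realify (compress Λ (op240 (deltaLocT (B1RG242Torus.α P a k * (P.L : ℝ) ^ (k * P.d)) P.eps⁻¹ (gaugeAct h (expGauge P e A)) k
            (cubeFamB hPd (P.L ^ k) c M0 sg W (L ^ k * L ^ s)) (lamFam hPd (P.L ^ k) c M0 sg) (cutoff R₁ R₀ (B5Ineq137Torus.T P 0)))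
            ((B1RG242Torus.α P a k * (P.L : ℝ) ^ (k * P.d)) / B1.aSeq a P.L k * κ') (lineIter (gaugeAct h (expGauge P e A)) k)))) Es N =
          Real.exp (-(Es * N)) * (Real.sqrt (2 * Real.pi) ^ Fintype.card (↥Λ × Fin 2) /
            Real.sqrt (realify (compress Λ (op240 (deltaLocT (B1RG242Torus.α P a k * (P.L : ℝ) ^ (k * P.d)) P.eps⁻¹ (gaugeAct h (expGauge P e A)) k
            (cubeFamB hPd (P.L ^ k) c M0 sg W (L ^ k * L ^ s)) (lamFam hPd (P.L ^ k) c M0 sg) (cutoff R₁ R₀ (B5Ineq137Torus.T P 0)))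
            ((B1RG242Torus.α P a k * (P.L : ℝ) ^ (k * P.d)) / B1.aSeq a P.L k * κ') (lineIter (gaugeAct h (expGauge P e A)) k)))).det) ∧
        0 < Z49 (realify (compress Λ (op240 (deltaLocT (B1RG242Torus.α P a k * (P.L : ℝ) ^ (k * P.d)) P.eps⁻¹ (gaugeAct h (expGauge P e A)) k
            (cubeFamB hPd (P.L ^ k) c M0 sg W (L ^ k * L ^ s)) (lamFam hPd (P.L ^ k) c M0 sg) (cutoff R₁ R₀ (B5Ineq137Torus.T P 0)))
            ((B1RG242Torus.α P a k * (P.L : ℝ) ^ (k * P.d)) / B1.aSeq a P.L k * κ') (lineIter (gaugeAct h (expGauge P e A)) k)))) Es N := by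
  obtain ⟨s₀, H⟩ := Z49_regular_torus_cwt_uniform_gaugeAct d L hL ha e creg β hcreg hβ hκ' Mmax
  refine ⟨s₀, fun s hs => ?_⟩
  obtain ⟨e₁, θ₀, ρ₀, he₁, hθ₀, hρ₀, M⟩ := H s hs
  refine ⟨e₁, θ₀, ρ₀, he₁, hθ₀, hρ₀, ?_⟩
  intro P hPd hPL k hk1 hkK hks hk' hsize A ec hec hece hreg hθ Asup hsup hAs c M0 hfit0 sg W hsg R R₀ R₁ hRρ hR₁ρ hR10 hMm hW hgap Λ hΛ
    h Es N
  obtain ⟨hInt, hTree, hσ⟩ := smallness454_of_sup hPd hPL hL (by omega) e hsup hAs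
  exact M P hPd hPL k hk1 hkK hks hk' hsize A ec hec hece hreg hθ c M0 hfit0 sg W hsg R R₀ R₁ hRρ hR₁ρ hR10 hMm hW hgap Λ hΛ _ _ hInt hTree
    hσ h Es N

/-- **(2.41) ON THE WHOLE GAUGE ORBIT OF A (2.23)-REGULAR, SUP-SMALL `A`, CONSTANTS CHOSEN BEFORE THE INSTANCE** — [I] p. 326 *«by change of gauge
… exp[ie_kηA], where A is smooth and small»*: hypotheses on the representative `A` only; for EVERY `h : T_ε → U(1)` and all `x₁, x₂ ∈ Λ`,
`‖C^{(k)}_Λ(u; x₁, x₂)‖ ≤ (a_k/A)·c₂·e^{−δ₁|x₁−x₂|_{T^{(k)}}}` at `u = (e^{ieεA})^h`. [cite: BalabanImbrieJaffe1988, (2.41) p.264]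
[cite: BalabanImbrieJaffe1985, p.326 «exp[ie_kηA]»] -/
theorem decay241_regular_torus_cwt_uniform_gaugeAct_of_sup (d L : ℕ) (hL : 2 ≤ L) {a : ℝ} (ha : 0 < a) (e creg β : ℝ)
    (hcreg : 0 ≤ creg) (hβ : 0 < β) {κ' : ℝ} (hκ' : 0 < κ') (Mmax : ℕ) :
    ∃ s₀ : ℕ, ∀ s : ℕ, s₀ ≤ s → ∃ e₁ θ₀ ρ₀ δ₁ c₂ : ℝ, 0 < e₁ ∧ 0 < θ₀ ∧ 0 < ρ₀ ∧ 0 < δ₁ ∧ 0 < c₂ ∧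
      ∀ (P : Params) (hPd : P.d = d + 1), P.L = L → ∀ (k : ℕ), 1 ≤ k → k ≤ P.K → k + s ≤ P.m + P.K → k + 1 ≤ P.m + P.K →
      3 * (L ^ k * L ^ s) ≤ P.sitesPerDir 0 →
      ∀ (A : PBond P 0 → ℝ) (ec : ℝ), 0 < ec → ec ≤ e₁ →
      (∀ (z : Balaban1983to89.Site P 0) (μ ν : Fin P.d),
          P.spacing k * |e| / ec * |A ⟨z.shift μ, ν⟩ - A ⟨z, ν⟩| ≤ creg * ec ^ (β - 1) / (L : ℝ) ^ k) →
      (2 * creg * ec ^ β) ^ 2 ≤ θ₀ →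
      ∀ (Asup : ℝ), (∀ b, |A b| ≤ Asup) → P.spacing k * |e| * Asup ≤ 1 / (4 * ((d : ℝ) + 1) * L) →
      ∀ (c M0 : Fin (d + 1) → ℕ), (∀ i, c i * P.L ^ k + P.L ^ k * M0 i ≤ P.sitesPerDir 0) →
      ∀ (sg W : ℕ), 1 ≤ sg → ∀ (R R₀ R₁ : ℝ), ((rowMargin L (d + 1) k s : ℕ) : ℝ) + ρ₀ * (L : ℝ) ^ k ≤ R → ρ₀ * (L : ℝ) ^ k ≤ R₁ →
        R₁ < R₀ → ((⌊(((P.L : ℝ) ^ k) - 1 + R₀) / sg⌋₊ + 3) ^ (d + 1) ≤ Mmax) →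
        2 * (sg : ℝ) / 3 + R₀ / 2 + R ≤ W → (∀ i, ((P.L ^ k * M0 i : ℕ) : ℝ) + R ≤ P.sitesPerDir 0) →
      ∀ (Λ : Finset (Balaban1983to89.Site P (0 + k))),
        (∀ y₁ ∈ Λ, ∀ μ, (c (Fin.cast hPd μ) : ℝ) * P.L ^ k + (R₀ + R) ≤ (P.L : ℝ) ^ k * (y₁ μ).val ∧
          (P.L : ℝ) ^ k * (y₁ μ).val + P.L ^ k + (R₀ + R) ≤ (c (Fin.cast hPd μ) : ℝ) * P.L ^ k + (P.L : ℝ) ^ k * M0 (Fin.cast hPd μ)) →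
      ∀ (h : GaugeTransf P 0 U1) (x₁ x₂ : ↥Λ),
        ‖(compress Λ (op240 (deltaLocT (B1RG242Torus.α P a k * (P.L : ℝ) ^ (k * P.d)) P.eps⁻¹ (gaugeAct h (expGauge P e A)) k
            (cubeFamB hPd (P.L ^ k) c M0 sg W (L ^ k * L ^ s)) (lamFam hPd (P.L ^ k) c M0 sg) (cutoff R₁ R₀ (B5Ineq137Torus.T P 0)))
            ((B1RG242Torus.α P a k * (P.L : ℝ) ^ (k * P.d)) / B1.aSeq a P.L k * κ') (lineIter (gaugeAct h (expGauge P e A)) k)))⁻¹ x₁ x₂‖ ≤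
          ((B1RG242Torus.α P a k * (P.L : ℝ) ^ (k * P.d)) / B1.aSeq a P.L k)⁻¹ * c₂ *
            Real.exp (-(δ₁ * B5Ineq137Torus.T P (0 + k) x₁ x₂)) := by
  obtain ⟨s₀, H⟩ := decay241_regular_torus_cwt_uniform_gaugeAct d L hL ha e creg β hcreg hβ hκ' Mmax
  refine ⟨s₀, fun s hs => ?_⟩
  obtain ⟨e₁, θ₀, ρ₀, δ₁, c₂, he₁, hθ₀, hρ₀, hδ₁, hc₂, M⟩ := H s hs
  refine ⟨e₁, θ₀, ρ₀, δ₁, c₂, he₁, hθ₀, hρ₀, hδ₁, hc₂, ?_⟩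
  intro P hPd hPL k hk1 hkK hks hk' hsize A ec hec hece hreg hθ Asup hsup hAs c M0 hfit0 sg W hsg R R₀ R₁ hRρ hR₁ρ hR10 hMm hW hgap Λ hΛ
    h x₁ x₂
  obtain ⟨hInt, hTree, hσ⟩ := smallness454_of_sup hPd hPL hL (by omega) e hsup hAs
  exact M P hPd hPL k hk1 hkK hks hk' hsize A ec hec hece hreg hθ c M0 hfit0 sg W hsg R R₀ R₁ hRρ hR₁ρ hR10 hMm hW hgap Λ hΛ _ _ hInt hTree
    hσ h x₁ x₂

end SupThreshold

end

end Literature.MathematicalPhysics.QuantumFieldTheory.BalabanImbrieJaffe1984to88.BIJ88Decay241RegularTorusCwtOrbit
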